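import Summits.QuantumFields.BalabanUV.Beta.StepReflectionRecSlot
import Summits.QuantumFields.BalabanUV.Beta.S0NAtReflection

/-!
# `BalabanUV.Beta.S0NOfReflection` — binder row D1, RULING R-D1-g28-2 FILE E4: (Sr-conj) AT `j = 0` FOR THE SLOTTED NATIVE SPINE `S0NOf V H cE cVH cΛ`,
# every jet bond — the slot-generic twin of an3-g28's `S0NAtReflection.S0NAt_bref`: against a level-0 spread `B₀` whose field block is `bhK`'s, with the
# border-reading generator `ctGenM B₀`, from the table letters (V-r)(V-ff0)(H-r) and the normalisation `2·cVH = −cE·Lc^{d+1}` (the literal's pins)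

HONEST FRAMING (cell charter, verbatim): «discharging BetaPertH makes Balaban's UV stability UNCONDITIONAL — a real constructive-QFT result; it is
NOT the continuum limit and NOT the Clay problem.»  HONEST DEPENDENCY: continuum YM on T⁴ ⇐ BetaPertH ∧ nine spine estimates (0/9 proved); BetaPertH
⇐ (D1) ∧ (D4) ∧ CAP+tail; G-an2-4 gates asym, D1 and NE2/3/4.  DERIVED cell leaf (β sub-cell, BINDER-OWNERS row D1 OWNER `b2b-balaban-beta-an2`, gen 28).
WHAT ([folklore] over an3's `WilsonReflectionContact.wilsonA_bref_inl_inl_conjV`, an2's `LambdaPieceReflection.SLam_reflect`∕`lamCoeffOf_KInv_reflect`,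
`StepReflectionRecSlot.smul_slot_bref_of_border` BY NAME):
* §1 `S0NOf_apply3` (the three slices entrywise); `SLam_lamCoeffOf_reflect_slot` (Λ slice, pure sign from (H-r)); `conjV_diagK_ctGenM_inl_inl_of_ff`
  (the field–field block of the contact sees only `B₀_ff = bhK_ff` and the generator's field leg: it EQUALS the comb's `conjV (bhKAt ρ_c) (diagK ctGen)` there).
* §2 the law blockwise: `S0NOf_bref_inl_inr ∕ _inr_inl ∕ _inr_inr` for every coefficient triple (V carries the contact, Wilson has no border, Λ pure sign);
  `S0NOf_bref_inl_inl` under `2·cVH = −cE·Lc^{d+1}` (Wilson's `c_W = −½` contact IS the vh coefficient's; V has no field block).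
* §3 **`S0NOf_bref`**: under `2·cVH = −cE·Lc^{d+1}`, for every `α κ′ u`,
  `S0NOf V H cE cVH cΛ κ′ (bref α κ′ u) = reflSign α κ′ • refK (Φ Lc α) (S0NOf … κ′ u + conjV B₀ ((cVH / Lc^{d+1}) • diagK (ctGenM d B₀ α Lc κ′ u)))`.
LETTERS (hypotheses; for the (0.4) literal `B₀ = bhK Lc + Dsh` with (Dff), `V = tabs.V`, `H = tabs.H`): (B₀-ff) `B₀_ff = bhK_ff`; (V-r) on the three border
leg pairs against `B₀` with coefficient `(Lc^{d+1})⁻¹`; (V-ff0); (H-r).  HONEST: bookkeeping; discharges NOTHING of the row: root-level classes 0∕5; tables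
0∕5; NOT D1, NOT `BetaPertH`, NOT continuum, NOT Clay.  No statement of Bałaban's papers, no `[cite:]`, no `Prop` fact, no `def`.  Provenance: β sub-cell,
unit beta-an2 gen 28, 2026-08-21 (v1); pattern `S0NAtReflection` (an3 gen 28) BY NAME; no existing file touched.
-/

open Finset
open scoped BigOperators
open Literature.MathematicalPhysics.QuantumFieldTheory
open Literature.MathematicalPhysics.QuantumFieldTheory.Balaban1983to89
open Literature.MathematicalPhysics.QuantumFieldTheory.Balaban1983to89.Beta
open ExpKernelCalculus (MKer comp)
open AveragingContoursRooted (ctr ctrOff)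
open StepJetData (wilsonA)
open PolarizationSign (reflSign)
open KernelReflection (LegMap refK refK_apply)
open ResolventReflection (bref Φ Φ_r_inl Φ_r_inr Φ_s_inl Φ_s_inr)
open OneStepResolventKernel (Fib KInv)
open InterLevelTransport (SLam)
open BalabanStepJets (lamCoeffOf)
open Summit.QuantumFields.BalabanUV.Beta.ChartConjugation (conjV)
open Summit.QuantumFields.BalabanUV.Beta.BorderedHessian (bhK bhKAt bhKAt_inl_inl diagK conjV_diagK_apply ctGen ctGen_inl)
open Summit.QuantumFields.BalabanUV.Beta.E3ContactGenerator (ctGenM ctGenM_inl)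
open Summit.QuantumFields.BalabanUV.Beta.SpineRooted (S0NOf conjV_smul_right SLam_reflect lamCoeffOf_KInv_reflect)
open Summit.QuantumFields.BalabanUV.Beta.WilsonReflectionContact (wilsonA_bref_inl_inl_conjV wilsonA_inl_inr wilsonA_inr_inl wilsonA_inr_inr)
open Summit.QuantumFields.BalabanUV.Beta.StepReflectionRecSlot (smul_slot_bref_of_border)

noncomputable section

namespace Summit.QuantumFields.BalabanUV.Beta.S0NOfReflection

variable {d : ℕ} {Lc : ℕ} [NeZero Lc]

/-! ## §1 Slices -/

/-- [folklore] The three slices of `S0NOf`, entrywise. -/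
theorem S0NOf_apply3 (V H : Fin (d + 1) → (Fin (d + 1) → ℤ) → MKer (d + 1) (Fib d)) (cE cVH cΛ : ℝ) (κ' : Fin (d + 1))
    (u x z : Fin (d + 1) → ℤ) (a b : Fib d) :
    S0NOf d Lc V H cE cVH cΛ κ' u x z a b =
      cE * wilsonA d κ' u x z a b + cVH * V κ' u x z a b + cΛ * SLam Lc (lamCoeffOf (KInv (N := Lc) (d := d)) Lc) H κ' u x z a b := by
  simp only [S0NOf, Pi.add_apply, Pi.smul_apply, smul_eq_mul]

/-- [folklore] **THE Λ SLICE AT `j = 0` WITH A GENERIC HESSIAN TABLE REFLECTS BY A PURE SIGN**, given (H-r). -/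
theorem SLam_lamCoeffOf_reflect_slot {H : Fin (d + 1) → (Fin (d + 1) → ℤ) → MKer (d + 1) (Fib d)}
    (hH : ∀ (α μ : Fin (d + 1)) (y : Fin (d + 1) → ℤ), H μ (bref α μ y) = reflSign α μ • refK (Φ (d := d) Lc α) (H μ y))
    (α κ' : Fin (d + 1)) (u : Fin (d + 1) → ℤ) :
    SLam Lc (lamCoeffOf (KInv (N := Lc) (d := d)) Lc) H κ' (bref α κ' u) =
      reflSign α κ' • refK (Φ Lc α) (SLam Lc (lamCoeffOf (KInv (N := Lc) (d := d)) Lc) H κ' u) :=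
  SLam_reflect (fun μ y κ'' u' => lamCoeffOf_KInv_reflect α μ y κ'' u') (fun μ y => hH α μ y) κ' u

/-- [folklore] Its entries. -/
theorem SLam_lamCoeffOf_reflect_slot_apply {H : Fin (d + 1) → (Fin (d + 1) → ℤ) → MKer (d + 1) (Fib d)}
    (hH : ∀ (α μ : Fin (d + 1)) (y : Fin (d + 1) → ℤ), H μ (bref α μ y) = reflSign α μ • refK (Φ (d := d) Lc α) (H μ y))
    (α κ' : Fin (d + 1)) (u x z : Fin (d + 1) → ℤ) (a b : Fib d) :
    SLam Lc (lamCoeffOf (KInv (N := Lc) (d := d)) Lc) H κ' (bref α κ' u) x z a b =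
      reflSign α κ' * ((Φ (d := d) Lc α).s a * (Φ (d := d) Lc α).s b *
        SLam Lc (lamCoeffOf (KInv (N := Lc) (d := d)) Lc) H κ' u ((Φ (d := d) Lc α).r a x) ((Φ (d := d) Lc α).r b z) a b) := by
  rw [SLam_lamCoeffOf_reflect_slot hH α κ' u]
  simp only [Pi.smul_apply, smul_eq_mul, refK_apply]

omit [NeZero Lc] in
/-- [folklore] **THE FIELD–FIELD BLOCK OF THE CONTACT SEES ONLY `B₀_ff = bhK_ff` AND THE GENERATOR'S FIELD LEG**: it equals the comb's
`conjV (bhKAt d ρ_c Lc) (diagK (ctGen d α Lc κ′ u))` there. -/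
theorem conjV_diagK_ctGenM_inl_inl_of_ff {B₀ : MKer (d + 1) (Fib d)}
    (hB : ∀ (x z : Fin (d + 1) → ℤ) (β β' : Fin (d + 1)), B₀ x z (Sum.inl β) (Sum.inl β') = bhK Lc x z (Sum.inl β) (Sum.inl β'))
    (α κ' : Fin (d + 1)) (u x z : Fin (d + 1) → ℤ) (β β' : Fin (d + 1)) :
    conjV B₀ (diagK (ctGenM d B₀ α Lc κ' u)) x z (Sum.inl β) (Sum.inl β') =
      conjV (bhKAt d (ctr (d + 1) Lc) Lc) (diagK (ctGen d α Lc κ' u)) x z (Sum.inl β) (Sum.inl β') := by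
  rw [conjV_diagK_apply, conjV_diagK_apply, hB, bhKAt_inl_inl, ctGenM_inl, ctGenM_inl, ctGen_inl, ctGen_inl]

/-! ## §2 The law blockwise -/

section Blocks

variable {V H : Fin (d + 1) → (Fin (d + 1) → ℤ) → MKer (d + 1) (Fib d)} {B₀ : MKer (d + 1) (Fib d)} (cE cVH cΛ : ℝ) {α : Fin (d + 1)}
  (hH : ∀ (α' μ : Fin (d + 1)) (y : Fin (d + 1) → ℤ), H μ (bref α' μ y) = reflSign α' μ • refK (Φ (d := d) Lc α') (H μ y))
include hH

/-- [folklore] One border leg pair: the law from (V-r) there (Wilson has no border blocks, Λ is pure sign). -/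
theorem S0NOf_bref_of_border {a b : Fib d} (hW : ∀ (κ : Fin (d + 1)) (w x z : Fin (d + 1) → ℤ), wilsonA d κ w x z a b = 0)
    (hV : ∀ (κ' : Fin (d + 1)) (u x z : Fin (d + 1) → ℤ), V κ' (bref α κ' u) x z a b = (reflSign α κ' • refK (Φ (d := d) Lc α)
      (V κ' u + conjV B₀ ((((Lc : ℝ) ^ (d + 1))⁻¹) • diagK (ctGenM d B₀ α Lc κ' u)))) x z a b)
    (κ' : Fin (d + 1)) (u x z : Fin (d + 1) → ℤ) :
    S0NOf d Lc V H cE cVH cΛ κ' (bref α κ' u) x z a b =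
      (reflSign α κ' • refK (Φ Lc α) (S0NOf d Lc V H cE cVH cΛ κ' u +
        conjV B₀ ((cVH / (Lc : ℝ) ^ (d + 1)) • diagK (ctGenM d B₀ α Lc κ' u)))) x z a b := by
  have hv := smul_slot_bref_of_border (Lc := Lc) (𝕄 := B₀) one_ne_zero cVH (fun x' z' => (one_mul (B₀ x' z' a b)).symm) (hV κ' u) x z
  rw [one_mul] at hv
  simp only [Pi.smul_apply, Pi.add_apply, smul_eq_mul, refK_apply, conjV_smul_right] at hv
  rw [S0NOf_apply3, hv, SLam_lamCoeffOf_reflect_slot_apply hH]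
  simp only [Pi.smul_apply, Pi.add_apply, smul_eq_mul, refK_apply, conjV_smul_right, S0NOf_apply3, hW, mul_zero, zero_add]
  ring

/-- [folklore] **FIELD–FIELD BLOCK UNDER THE NORMALISATION** `2·cVH = −cE·Lc^{d+1}`: Wilson's contact (`c_W = −½`, an3) against `bhK_ff` is the vh coefficient's;
V has no field block; Λ is pure sign. -/
theorem S0NOf_bref_inl_inl (hn : 2 * cVH = -(cE * (Lc : ℝ) ^ (d + 1)))
    (hB : ∀ (x z : Fin (d + 1) → ℤ) (β β' : Fin (d + 1)), B₀ x z (Sum.inl β) (Sum.inl β') = bhK Lc x z (Sum.inl β) (Sum.inl β'))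
    (hV0 : ∀ (κ : Fin (d + 1)) (w x z : Fin (d + 1) → ℤ) (β β' : Fin (d + 1)), V κ w x z (Sum.inl β) (Sum.inl β') = 0)
    (κ' : Fin (d + 1)) (u x z : Fin (d + 1) → ℤ) (β β' : Fin (d + 1)) :
    S0NOf d Lc V H cE cVH cΛ κ' (bref α κ' u) x z (Sum.inl β) (Sum.inl β') =
      (reflSign α κ' • refK (Φ Lc α) (S0NOf d Lc V H cE cVH cΛ κ' u +
        conjV B₀ ((cVH / (Lc : ℝ) ^ (d + 1)) • diagK (ctGenM d B₀ α Lc κ' u)))) x z (Sum.inl β) (Sum.inl β') := by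
  have hL : ((Lc : ℝ) ^ (d + 1)) ≠ 0 := pow_ne_zero _ (by exact_mod_cast NeZero.ne Lc)
  have hγ : cVH / (Lc : ℝ) ^ (d + 1) = -(cE / 2) := by
    rw [div_eq_iff hL]; linarith
  simp only [Pi.smul_apply, Pi.add_apply, smul_eq_mul, refK_apply, conjV_smul_right, S0NOf_apply3, hV0, mul_zero, add_zero,
    SLam_lamCoeffOf_reflect_slot_apply hH, wilsonA_bref_inl_inl_conjV Lc, Φ_s_inl, Φ_r_inl, conjV_diagK_ctGenM_inl_inl_of_ff hB, hγ]
  ring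

end Blocks

/-! ## §3 The socket shape for the whole slotted spine -/

/-- [folklore] **(Sr-conj) AT `j = 0` FOR THE SLOTTED NATIVE SPINE, EVERY JET BOND**: under `2·cVH = −cE·Lc^{d+1}`, (B₀-ff) `B₀_ff = bhK_ff`, the table letters
(V-r) on the three border leg pairs against `B₀` (coefficient `(Lc^{d+1})⁻¹`, generator `ctGenM d B₀`), (V-ff0) and (H-r):
`S0NOf V H cE cVH cΛ κ′ (bref α κ′ u) = reflSign α κ′ • refK (Φ Lc α) (S0NOf … κ′ u + conjV B₀ ((cVH / Lc^{d+1}) • diagK (ctGenM d B₀ α Lc κ′ u)))`. -/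
theorem S0NOf_bref {V H : Fin (d + 1) → (Fin (d + 1) → ℤ) → MKer (d + 1) (Fib d)} {B₀ : MKer (d + 1) (Fib d)} {cE cVH : ℝ} (cΛ : ℝ)
    (hn : 2 * cVH = -(cE * (Lc : ℝ) ^ (d + 1))) {α : Fin (d + 1)}
    (hB : ∀ (x z : Fin (d + 1) → ℤ) (β β' : Fin (d + 1)), B₀ x z (Sum.inl β) (Sum.inl β') = bhK Lc x z (Sum.inl β) (Sum.inl β'))
    (hVfm : ∀ (κ' : Fin (d + 1)) (u x z : Fin (d + 1) → ℤ) (β μ : Fin (d + 1)), V κ' (bref α κ' u) x z (Sum.inl β) (Sum.inr μ) =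
      (reflSign α κ' • refK (Φ (d := d) Lc α) (V κ' u + conjV B₀ ((((Lc : ℝ) ^ (d + 1))⁻¹) • diagK (ctGenM d B₀ α Lc κ' u)))) x z (Sum.inl β) (Sum.inr μ))
    (hVmf : ∀ (κ' : Fin (d + 1)) (u x z : Fin (d + 1) → ℤ) (μ β : Fin (d + 1)), V κ' (bref α κ' u) x z (Sum.inr μ) (Sum.inl β) =
      (reflSign α κ' • refK (Φ (d := d) Lc α) (V κ' u + conjV B₀ ((((Lc : ℝ) ^ (d + 1))⁻¹) • diagK (ctGenM d B₀ α Lc κ' u)))) x z (Sum.inr μ) (Sum.inl β))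
    (hVmm : ∀ (κ' : Fin (d + 1)) (u x z : Fin (d + 1) → ℤ) (μ μ' : Fin (d + 1)), V κ' (bref α κ' u) x z (Sum.inr μ) (Sum.inr μ') =
      (reflSign α κ' • refK (Φ (d := d) Lc α) (V κ' u + conjV B₀ ((((Lc : ℝ) ^ (d + 1))⁻¹) • diagK (ctGenM d B₀ α Lc κ' u)))) x z (Sum.inr μ) (Sum.inr μ'))
    (hV0 : ∀ (κ : Fin (d + 1)) (w x z : Fin (d + 1) → ℤ) (β β' : Fin (d + 1)), V κ w x z (Sum.inl β) (Sum.inl β') = 0)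
    (hH : ∀ (α' μ : Fin (d + 1)) (y : Fin (d + 1) → ℤ), H μ (bref α' μ y) = reflSign α' μ • refK (Φ (d := d) Lc α') (H μ y))
    (κ' : Fin (d + 1)) (u : Fin (d + 1) → ℤ) :
    S0NOf d Lc V H cE cVH cΛ κ' (bref α κ' u) =
      reflSign α κ' • refK (Φ Lc α) (S0NOf d Lc V H cE cVH cΛ κ' u + conjV B₀ ((cVH / (Lc : ℝ) ^ (d + 1)) • diagK (ctGenM d B₀ α Lc κ' u))) := by
  funext x z a b
  rcases a with β | μ <;> rcases b with β' | μ'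
  · exact S0NOf_bref_inl_inl cE cVH cΛ hH hn hB hV0 κ' u x z β β'
  · exact S0NOf_bref_of_border cE cVH cΛ hH (fun κ w x z => wilsonA_inl_inr κ w x z β μ') (fun κ'' u' x' z' => hVfm κ'' u' x' z' β μ') κ' u x z
  · exact S0NOf_bref_of_border cE cVH cΛ hH (fun κ w x z => wilsonA_inr_inl κ w x z μ β') (fun κ'' u' x' z' => hVmf κ'' u' x' z' μ β') κ' u x z
  · exact S0NOf_bref_of_border cE cVH cΛ hH (fun κ w x z => wilsonA_inr_inr κ w x z μ μ') (fun κ'' u' x' z' => hVmm κ'' u' x' z' μ μ') κ' u x z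

end Summit.QuantumFields.BalabanUV.Beta.S0NOfReflection

end
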